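import Literature.MathematicalPhysics.QuantumLattice.ContinuumLimitLGT
import Literature.MathematicalPhysics.QuantumLattice.LatticeGaugeDLR
import HarnessLib

/-!
# The tangent perturbation is a bounded measurable cylinder observable
(helper T4b of the tangent programme, line `Sketch`, crux `FibreToTorus`)

For a local gauge-invariant observable `A` (`LocalGaugeObservable d G`) and `n : ℕ`, the
perturbation
`Ψ_n(U) = ∑_{x good} A(τ_x U)`, `τ_x = configShift (-x)` (so `(τ_x U) e = U (e.1 + x, e.2)`
and `A.F ∘ τ_x` has edge support `supp A + x`), summed over the sites `x ∈ [0, n)^d` whose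
translated support lies in the edge box `Λ_{n+1} = [0, n+1)^d × {directions}`, is

1. measurable (a finite sum of measurable functions);
2. a cylinder observable with support `Λ_{n+1}` (each summand depends only on
   `supp A + x ⊆ Λ_{n+1}`, by the filter condition);
3. bounded by `#good · C_A`, `C_A` a bound of `A`.
-/

noncomputable section
open MeasureTheory Filter Topology Finset
open Literature.Probability.LatticeModels (Site halfOpenBox)
open Literature.MathematicalPhysics.QuantumLattice (LGConfig ZdEdge configShift configShift_apply
  LocalGaugeObservable IsCylinder)

namespace Summit.QuantumFields.YangMills.Theorems.FibreToTorus

/-- The translate `U ↦ F (configShift (-x) U)` of a cylinder observable `F` with edge support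
`S` is a cylinder observable with edge support `S + x = {(e.1 + x, e.2) | e ∈ S}`
(cf. `IsCylinder.comp_configShift`). [folklore] -/
private theorem isCylinder_comp_configShift_neg {d : ℕ} {G : Type} [MeasurableSpace G]
    {F : LGConfig d G → ℝ} {S : Finset (ZdEdge d)} (hF : IsCylinder F S) (x : Site d) :
    IsCylinder (fun U : LGConfig d G => F (configShift (-x) U))
      (S.image fun e => (e.1 + x, e.2)) := by
  intro U V hUV
  refine hF fun e he => ?_
  have h2 : e.1 - -x = e.1 + x := sub_neg_eq_add e.1 x
  rw [configShift_apply, configShift_apply, h2]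
  exact hUV (e.1 + x, e.2)
    (Finset.mem_coe.2 (Finset.mem_image.2 ⟨e, Finset.mem_coe.1 he, rfl⟩))

/-- **T4b.** The tangent perturbation `Ψ_n = ∑_{x good} A ∘ configShift (-x)` (sum over the
sites `x ∈ [0, n)^d` with `supp A + x ⊆ Λ_{n+1} = [0, n+1)^d × {directions}`) is measurable,
a cylinder observable with support `Λ_{n+1}`, and bounded. [folklore] -/
theorem tangent_perturbation_cylinder : ∀ (d : ℕ) (G : Type) [Group G] [MeasurableSpace G] (A : LocalGaugeObservable d G) (n : ℕ), Measurable (fun U : LGConfig d G => ∑ x ∈ (halfOpenBox d n).filter (fun x => A.supp.image (fun e => (e.1 + x, e.2)) ⊆ halfOpenBox d (n + 1) ×ˢ (Finset.univ : Finset (Fin d))), A.F (configShift (-x) U)) ∧ IsCylinder (fun U : LGConfig d G => ∑ x ∈ (halfOpenBox d n).filter (fun x => A.supp.image (fun e => (e.1 + x, e.2)) ⊆ halfOpenBox d (n + 1) ×ˢ (Finset.univ : Finset (Fin d))), A.F (configShift (-x) U)) (halfOpenBox d (n + 1) ×ˢ (Finset.univ : Finset (Fin d))) ∧ ∃ C :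 ℝ, ∀ U : LGConfig d G, |∑ x ∈ (halfOpenBox d n).filter (fun x => A.supp.image (fun e => (e.1 + x, e.2)) ⊆ halfOpenBox d (n + 1) ×ˢ (Finset.univ : Finset (Fin d))), A.F (configShift (-x) U)| ≤ C := by
  intro d G _ _ A n
  refine ⟨?_, ?_, ?_⟩
  · -- (1) measurability: a finite sum of measurable functions
    exact Finset.measurable_sum _ fun x _ => A.measurable.comp (configShift (-x)).measurable
  · -- (2) cylinder with support `Λ_{n+1}`: each summand depends only on `supp A + x ⊆ Λ_{n+1}`
    intro U V hUV
    refine Finset.sum_congr rfl fun x hx => ?_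
    rw [Finset.mem_filter] at hx
    exact isCylinder_comp_configShift_neg A.isCylinder x fun e he =>
      hUV e (Finset.mem_coe.2 (hx.2 (Finset.mem_coe.1 he)))
  · -- (3) bound `#good · C_A`
    obtain ⟨C, hC⟩ := A.bounded
    exact ⟨_, fun U => (Finset.abs_sum_le_sum_abs _ _).trans
      (Finset.sum_le_card_nsmul _ _ C fun x _ => hC _)⟩

end Summit.QuantumFields.YangMills.Theorems.FibreToTorus

end
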